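import Summits.QuantumFields.YangMills.Theorems.LuscherReductionTraceDoorDefs
import Summits.QuantumFields.YangMills.Theorems.LuscherReductionTraceDoorBasics
import Summits.QuantumFields.YangMills.Theorems.LuscherReductionTraceDoorInvPrep
import Summits.QuantumFields.YangMills.Theorems.LuscherReductionRunningReductionTraceFormulaAveraging
import Summits.QuantumFields.YangMills.Theorems.LuscherReductionRunningReductionLevelGapSummable
import Summits.QuantumFields.YangMills.Theorems.LuscherReductionRunningReductionBOHandoverLabels
import Summits.QuantumFields.YangMills.Theorems.LuscherReductionTwistedTraceScalingBaseWindow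
import Summits.QuantumFields.YangMills.Theorems.LuscherReductionTwistedTraceScalingTowerOfUniform
import HarnessLib

/-!
# `TwistedTraceScaling` (crux stmt-QuantumFields-20203, route `LuscherReduction`, skeleton «twolattice»):
# negative-side support — the `β`-threshold of S-BASE and the `0 < ε` of the crux are load-bearing
# (refuter crux-disprover seat; this file does NOT refute the crux)

HONEST FRAMING: `TwistedTraceScaling` is a femto-rung (R2b1) crux of a CONDITIONAL reduction route; nothing here is a
mass-gap or Clay statement.  All objects are the tree's: `TT.physTrace`, `TraceDoor.traceRatio`, `TraceDoor.femtoSteps`,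
`TraceDoor.hTraceRatio`, `InFemtoWindow`, `luscherLambda`, `invRunningCoupling`, `oneSiteCoupling`.

Sorry-free content (standard axioms only):

* §1 the infinite-temperature point `β = 0` as a small model: the transfer kernel `K_0 ≡ 1`
  (`transferKernel_beta_zero`), the physical average of a constant is the constant (`physAvg_const`), hence every
  zero-flux trace `physTrace L 0 T = 1` (`physTrace_beta_zero`) and every dyadic trace ratio `traceRatio L 0 T = 1`
  (`traceRatio_beta_zero`), on every lattice size `L` and every `T`.
* §2 Lüscher's limiting ratio satisfies `0 < r_𝔥(s) ≤ 1/Z_𝔥(s) < 1` for `s > 0`, `Z_𝔥(s) = Σ_k e^{−sΔ_k} > 1`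
  (`hTraceRatio_pos`, `hTraceRatio_le_inv`, `hTraceRatio_lt_one`, `one_lt_tsum_exp_levelGap`).
* §3 `fixedLatticeTraceLaw_false_without_threshold`: the skeleton's S-BASE stub
  `stub_fixedLatticeTraceLaw := ∀ L₁ s>0 ε>0, ∃ β₁, ∀ β ≥ β₁, |traceRatio L₁ β (femtoSteps s β L₁) − hTraceRatio s| ≤ ε`
  becomes FALSE when the threshold `∃ β₁, ∀ β ≥ β₁` is replaced by `∀ β ≥ 0` (stated inline; no proposition is defined under
  `Summits/`): at `β = 0` the ratio is `1` while `r_𝔥(1) < 1`.  Moral for the BASE lane: any proof must use largeness of `β`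
  (equivalently smallness of `Λ(β, L₁)`); the statement is genuinely asymptotic even at `L₁ = 1`.
* §4 the femto window is never empty: for every depth `0 < lam ≤ 1` and every lattice size `L ≥ 1` some `β ≥ 1` has
  `Λ(β, L) = lam`, hence `InFemtoWindow lam β L` (`exists_inFemtoWindow`, from the tree's IVT lemma `Tower.exists_matched`); consequently the crux with the
  hypothesis `0 < ε` dropped is false (`twistedTraceScaling_false_without_epsPos`, witness `ε = −1`) — i.e. the window
  hypotheses of the crux are satisfiable at every admissible `(lam, L)`, so the crux is not vacuous.

Not formalisable here (recorded for provers/planners, paper-level, see the crux workfile `Cruxes/TwistedTraceScaling/Disproof.lean`):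
at `β = 0` BOTH sides of the crux equal `1` (`Λ(0,L) = 0`, `T = 0`, `oneSiteCoupling 0 L = 0`), so the `β = 0` model does not
separate the `L`-lattice from the one-site integral; the hypothesis `1 ≤ β` of `InFemtoWindow` excludes the strong-coupling branch of
the two-loop label, where the window equation has a second solution with `K_β ≈ 1`.
-/

set_option autoImplicit false

noncomputable section

open MeasureTheory Filter Topology Real
open Literature.MathematicalPhysics.QuantumFieldTheory hiding SU2
open Literature.MathematicalPhysics.QuantumLattice
open Literature.Analysis.OperatorTheory.YMMatrixModel
open scoped BigOperators

namespace Summit.QuantumFields.YangMills.Theorems.TwistedTraceScaling.Negative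

open Summit.QuantumFields.YangMills.Theorems.FemtoTransferGap
open Summit.QuantumFields.YangMills.Theorems.FemtoTransferGap.TraceDoor
open Summit.QuantumFields.YangMills.Theorems.FemtoTransferGap.TT
open Summit.QuantumFields.YangMills.Theorems.FemtoTransferGap.TwoLattice

/-! ## §1 The infinite-temperature point `β = 0`: `K_0 ≡ 1`, every zero-flux trace equals `1` -/

/-- At `β = 0` the transfer kernel is identically `1`. [folklore] -/
theorem transferKernel_beta_zero {L : ℕ} [NeZero L] (U V : GaugeConfig 3 L SU2) :
    transferKernel su2Rep 0 U V = 1 := by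
  simp [transferKernel]

/-- The physical average of a constant is that constant. [folklore] -/
theorem physAvg_const {L : ℕ} [NeZero L] (c : ℝ) (U : GaugeConfig 3 L SU2) :
    physAvg (fun _ => c) U = c := by
  have h := physAvg_eq_self_of_isPhys (L := L) (isPhys_const (G := SU2) (L := L) c)
  exact congrFun h U

/-- At `β = 0` every closed zero-flux kernel chain integrates to `1`. [folklore] -/
theorem physTraceSucc_beta_zero (L : ℕ) [NeZero L] (n : ℕ) : physTraceSucc L 0 n = 1 := by
  unfold physTraceSucc
  have h1 : ∀ U V : GaugeConfig 3 L SU2, transferKernel su2Rep (0 : ℝ) U V = 1 :=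
    fun U V => transferKernel_beta_zero U V
  have h2 : (fun Us : Fin (n + 1) → GaugeConfig 3 L SU2 =>
      (∏ i : Fin n, transferKernel su2Rep (0 : ℝ) (Us i.castSucc) (Us i.succ)) *
        physAvg (transferKernel su2Rep (0 : ℝ) (Us (Fin.last n))) (Us 0)) = fun _ => 1 := by
    funext Us
    have h3 : transferKernel su2Rep (0 : ℝ) (Us (Fin.last n)) = fun _ => (1 : ℝ) := funext (h1 _)
    rw [h3, physAvg_const]
    simp [h1]
  rw [h2]
  simp

/-- `Z_phys(L, 0, T) = 1` for every `T`. [folklore] -/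
theorem physTrace_beta_zero (L : ℕ) [NeZero L] (T : ℕ) : physTrace L 0 T = 1 :=
  physTraceSucc_beta_zero L (T - 1)

/-- Hence the dyadic trace ratio at `β = 0` is `1` for every `T`. [folklore] -/
theorem traceRatio_beta_zero (L : ℕ) [NeZero L] (T : ℕ) : traceRatio L 0 T = 1 := by
  simp [traceRatio, physTrace_beta_zero]

/-! ## §2 Lüscher's limiting ratio is strictly between `0` and `1`, and at most `1/Z_𝔥(s)` -/

/-- `Z_𝔥(2s) ≤ Z_𝔥(s)`: termwise `e^{−2sΔ_k} ≤ e^{−sΔ_k}` since `Δ_k ≥ 0`. [folklore] -/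
theorem tsum_exp_two_mul_le {s : ℝ} (hs : 0 < s) :
    ∑' k, Real.exp (-(2 * s) * levelGap k) ≤ ∑' k, Real.exp (-s * levelGap k) :=
  Summable.tsum_le_tsum (fun k => Real.exp_le_exp.mpr (by nlinarith [levelGap_nonneg k]))
    (LGS.levelGapSummable_all (2 * s) (by linarith)) (LGS.levelGapSummable_all s hs)

/-- `Z_𝔥(s) > 1`: the partial sum over the two lowest invariant levels is `1 + e^{−sΔ₁} > 1`. [folklore] -/
theorem one_lt_tsum_exp_levelGap {s : ℝ} (hs : 0 < s) : 1 < ∑' k, Real.exp (-s * levelGap k) := by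
  have h := (LGS.levelGapSummable_all s hs).sum_le_tsum (Finset.range 2) (fun k _ => (Real.exp_pos _).le)
  rw [Finset.sum_range_succ, Finset.sum_range_one, levelGap_zero, mul_zero, Real.exp_zero] at h
  have h1 : 0 < Real.exp (-s * levelGap 1) := Real.exp_pos _
  linarith

/-- `r_𝔥(s) ≤ 1/Z_𝔥(s)` with `Z_𝔥(s) = Σ_k e^{−sΔ_k}` (termwise `e^{−2sΔ} ≤ e^{−sΔ}`). [folklore] -/
theorem hTraceRatio_le_inv {s : ℝ} (hs : 0 < s) :
    hTraceRatio s ≤ 1 / ∑' k, Real.exp (-s * levelGap k) := by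
  unfold hTraceRatio seqRatio
  have hZ₁ : 0 < ∑' k, Real.exp (-s * levelGap k) := tsum_exp_levelGap_pos hs
  have h21 := tsum_exp_two_mul_le hs
  calc (∑' k, Real.exp (-(2 * s) * levelGap k)) / (∑' k, Real.exp (-s * levelGap k)) ^ 2
      ≤ (∑' k, Real.exp (-s * levelGap k)) / (∑' k, Real.exp (-s * levelGap k)) ^ 2 :=
        div_le_div_of_nonneg_right h21 (by positivity)
    _ = 1 / ∑' k, Real.exp (-s * levelGap k) := by
        field_simp

/-- `r_𝔥(s) < 1` for every `s > 0` (there is at least one excited invariant level). [folklore] -/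
theorem hTraceRatio_lt_one {s : ℝ} (hs : 0 < s) : hTraceRatio s < 1 := by
  have hZ := one_lt_tsum_exp_levelGap hs
  have hZpos : 0 < ∑' k, Real.exp (-s * levelGap k) := by linarith
  calc hTraceRatio s ≤ 1 / ∑' k, Real.exp (-s * levelGap k) := hTraceRatio_le_inv hs
    _ < 1 := by rw [div_lt_one hZpos]; exact hZ

/-- `0 < r_𝔥(s)`. [folklore] -/
theorem hTraceRatio_pos {s : ℝ} (hs : 0 < s) : 0 < hTraceRatio s := by
  unfold hTraceRatio seqRatio
  exact div_pos (tsum_exp_levelGap_pos (by linarith)) (pow_pos (tsum_exp_levelGap_pos hs) 2)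

/-! ## §3 S-BASE is false without its `β`-threshold (the witness is `β = 0`) -/

/-- **`stub_fixedLatticeTraceLaw` is false without its threshold `β₁`**: replacing `∃ β₁, ∀ β ≥ β₁` by `∀ β ≥ 0` is refuted at
`β = 0`, where every trace ratio is `1` while `r_𝔥(s) < 1`. [folklore] -/
theorem fixedLatticeTraceLaw_false_without_threshold :
    ¬ (∀ (L1 : ℕ) [NeZero L1] (s : ℝ), 0 < s → ∀ ε : ℝ, 0 < ε → ∀ β : ℝ, 0 ≤ β →
        |traceRatio L1 β (femtoSteps s β L1) - hTraceRatio s| ≤ ε) := by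
  intro h
  have hr : hTraceRatio 1 < 1 := hTraceRatio_lt_one one_pos
  have hε : 0 < (1 - hTraceRatio 1) / 2 := by linarith
  have h1 := h 1 1 one_pos ((1 - hTraceRatio 1) / 2) hε 0 le_rfl
  rw [traceRatio_beta_zero] at h1
  have h2 := (abs_le.mp h1).2
  linarith

/-! ## §4 The femto window is never empty; the crux is false without `0 < ε` -/

/-- **The femto window is inhabited** at every depth `0 < lam ≤ 1` on every lattice: some `β ≥ 1` has `Λ(β, L) = lam`. [folklore] -/
theorem exists_inFemtoWindow (L : ℕ) [NeZero L] {lam : ℝ} (h0 : 0 < lam) (h1 : lam ≤ 1) :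
    ∃ β : ℝ, InFemtoWindow lam β L ∧ luscherLambda β L = lam := by
  have hv : (1 : ℝ) ≤ 1 / lam ^ 3 := by
    rw [le_div_iff₀ (by positivity)]
    have : lam ^ 3 ≤ 1 := pow_le_one₀ h0.le h1
    linarith
  obtain ⟨β, hβ1, hval⟩ := Tower.exists_matched L hv
  have hvpos : 0 < invRunningCoupling β L := by rw [hval]; positivity
  have h3 : luscherLambda β L ^ 3 = lam ^ 3 := by
    rw [BOHandover.luscherLambda_pow_three hvpos, hval, one_div, inv_inv]
  have hnn : 0 ≤ luscherLambda β L := by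
    unfold luscherLambda; exact Real.rpow_nonneg (le_max_right _ _) _
  have heq : luscherLambda β L = lam := (pow_left_inj₀ hnn h0.le (by norm_num : (3 : ℕ) ≠ 0)).1 h3
  exact ⟨β, ⟨hβ1, by rw [heq], by rw [heq]; linarith⟩, heq⟩

/-- **The crux is false without `0 < ε`**: the window is inhabited, so `|·| ≤ ε` fails for `ε = −1`. [folklore] -/
theorem twistedTraceScaling_false_without_epsPos :
    ¬ (∀ s : ℝ, 0 < s → ∀ ε : ℝ, ∃ lam0 : ℝ, 0 < lam0 ∧ ∀ lam : ℝ, 0 < lam → lam ≤ lam0 → ∃ L0 : ℕ,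
        ∀ (L : ℕ) [NeZero L], L0 ≤ L → ∀ β : ℝ, InFemtoWindow lam β L →
          |physTrace L β (2 * ⌈s * L / luscherLambda β L⌉₊) / physTrace L β ⌈s * L / luscherLambda β L⌉₊ ^ 2 -
            physTrace 1 (oneSiteCoupling β L) (2 * ⌈s * L / luscherLambda β L⌉₊) /
              physTrace 1 (oneSiteCoupling β L) ⌈s * L / luscherLambda β L⌉₊ ^ 2| ≤ ε) := by
  intro h
  obtain ⟨lam0, hlam0, H⟩ := h 1 one_pos (-1)
  have hl : 0 < min lam0 1 := lt_min hlam0 one_pos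
  obtain ⟨L0, HL⟩ := H (min lam0 1) hl (min_le_left _ _)
  haveI : NeZero (max L0 1) := ⟨Nat.one_le_iff_ne_zero.mp (le_max_right _ _)⟩
  obtain ⟨β, hW, -⟩ := exists_inFemtoWindow (max L0 1) hl (min_le_right _ _)
  have h1 := HL (max L0 1) (le_max_left _ _) β hW
  linarith [abs_nonneg (physTrace (max L0 1) β (2 * ⌈(1 : ℝ) * (max L0 1 : ℕ) / luscherLambda β (max L0 1)⌉₊) /
      physTrace (max L0 1) β ⌈(1 : ℝ) * (max L0 1 : ℕ) / luscherLambda β (max L0 1)⌉₊ ^ 2 -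
    physTrace 1 (oneSiteCoupling β (max L0 1)) (2 * ⌈(1 : ℝ) * (max L0 1 : ℕ) / luscherLambda β (max L0 1)⌉₊) /
      physTrace 1 (oneSiteCoupling β (max L0 1)) ⌈(1 : ℝ) * (max L0 1 : ℕ) / luscherLambda β (max L0 1)⌉₊ ^ 2)]

end Summit.QuantumFields.YangMills.Theorems.TwistedTraceScaling.Negative

end
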